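import Summits.QuantumFields.YangMills.Theorems.UnitScaleTiltProp7TrueLinSourcedDefectL1Rows
import HarnessLib

/-!
# Route `UnitScaleTilt`, crux K1 «MinimiserStabilityRegPr» (stmt-QuantumFields-19200), route-R (β) (n3)-comb lane (II), ★routeR-w1 g9 PENS ROUND 4 file F-7c-1 —
# THE LEVEL INDUCTION OF THE SOURCED CORNER-COMB TOWER (PURE REALS): the MASS line `m_{j+1} ≤ (ρ + κ′_j)·m_j` and the GRADIENT line `g_{j+1} ≤ ρ_g·g_j + κ_j·m_j`
# close, for coefficients GEOMETRIC FROM THE TOP (`κ_j, κ′_j ≤ θ·ρ^{4(k₀−j)}` — the RegPr plaquette sizes `p_j = 4ε₀L^{−2(k₀−j)}` at `ρ² = L⁻¹`), as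
# `m_k ≤ E·ρ^k·m_0` and `g_k ≤ ρ_g^k·g_0 + θ·E·m_0·ρ^{k+3}∕(1−ρ²)` at `ρ_g = ρ⁻¹` (d = 3) — the mass fed into the gradients keeps the mass line's own decay

Cell `ym3-torus`, width seat `ym-ust-19200-w5` (gen 8); ★routeR-w1 g9 2026-08-29T08:50:39Z «F-7c LEVEL INDUCTION + T³ NUMERALS → open offer», «w5 g8: F-7c MINE» 08:50:59Z.
THEOREMS ONLY (0 `def`, 0 `sorry`); `--supports stmt-QuantumFields-19200 --as helper`, count-neutral.  Pure real sequences (Mathlib only + the landed recursion lemma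
✓`Prop7TrueLinSourcedDefectL1Rows.sourced_recursion_bound_init`, imported, not re-proved).  YM₃ on T³ is a ladder rung (R3), not the Clay problem; nothing here claims
`hMcomb`, `hMcomb₂`, (β), the stub, the crux, d = 4 or the mass gap.

WHY (MASTER `DESIGN-N3COMB-LINEAR-CORE` §1∕§5, PENS ROUND 4).  F-7b (★routeR-w4) delivers, per level of the sourced corner-comb tower `G̃`, the two Minkowski rows
`m (j+1) ≤ (ρ + κ′ j)·m j` (`ρ = √(L²L⁻ᵈ)`, `κ′ j` = DEF + two-block source coefficients) and `g (j+1) ≤ ρ_g·g j + κ j·m j` (`ρ_g = L^{(4−d)∕2}`, `κ j` = crude gradients of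
DEF∕rem), all coefficients `∝ p_j`, geometric from the top level `k₀ = K − n`.  F-8 (the torus knit) consumes CLOSED bounds at every level `k ≤ k₀` in which (a) the mass
decays like `ρ^k` (the A-slot `(Lᵏ)⁻¹` after squaring at d = 3) and (b) the gradient grows at most like `ρ_g^k` (the B-slot `Lᵏ`) PLUS a mass feed that must itself carry
the A-slot decay — no level-uniform `O(ε₀)·m_0` may appear (MASTER (R4)).  At d = 3, `ρ_g·ρ = 1` and `p_j = 4ε₀·ρ^{4(k₀−j)}`, and the feed
`Σ_{j<k} ρ_g^{k−1−j}·κ_j·m_j ≤ θE·m_0·Σ_{j<k} ρ^{4k₀−k+1−2j} ≤ θE·m_0·ρ^{k+3}∕(1−ρ²)` indeed decays like the mass line (§3).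

WHAT IS PROVED (ns `…Theorems.Prop7CornerCombLevelInduction`; every sequence∕constant a free real with its sign displayed).
* §1 `geom_sum_top_le` — `Σ_{j<k} ρ^{4(k₀−j)} ≤ ρ⁴∕(1−ρ⁴)` for `k ≤ k₀` (`exp x ≤ 1 + 2x` on `[0,1]` is lit `Literature.NumberTheory.Sieve.exp_le_one_add_two_mul`, not restated).
* §2 ★`mass_line_le` — `m k ≤ exp(ρ⁻¹·Σ_{j<k} κ′ j)·ρ^k·m 0`; ★`mass_line_le_geom` — with `κ′ j ≤ θ′·ρ^{4(k₀−j)}`: `m k ≤ exp(θ′·ρ³∕(1−ρ⁴))·ρ^k·m 0` (`k ≤ k₀`).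
* §3 ★`grad_line_le` — `g k ≤ ρ_g^k·g 0 + Σ_{j<k} ρ_g^{k−1−j}·(κ j·m j)` (any `ρ_g > 0`); `inv_pow_mul_pow_le` (`(ρ⁻¹)^{k−1−j}·ρ^j·ρ^{4(k₀−j)} ≤ ρ^{k+3}·(ρ²)^{k−1−j}`);
  ★★`feed_sum_le` — at `ρ_g = ρ⁻¹`, `κ j ≤ θ·ρ^{4(k₀−j)}`, `m j ≤ E·ρ^j·m 0`: `Σ_{j<k} (ρ⁻¹)^{k−1−j}·(κ j·m j) ≤ θ·E·m 0·ρ^{k+3}∕(1−ρ²)`;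
  ★★★`grad_line_le_geom` — the two lines together: `g k ≤ (ρ⁻¹)^k·g 0 + θ·exp(θ′ρ³∕(1−ρ⁴))·m 0·ρ^{k+3}∕(1−ρ²)` (`k ≤ k₀`).
* §4 ★`mass_line_sq_le_geom` ∕ ★`grad_line_sq_le_geom` — the squared forms F-8 sums (`m k² ≤ exp(2·…)·(ρ²)^k·m 0²`, `g k² ≤ 2(ρ²)^{−k}·g 0² + 2θ²·exp(2·…)·m 0²·(ρ²)^{k+3}∕(1−ρ²)²`).
* §5 `pow_mul_pow_mul_pow_le`, ★★`sourced_line_le_geom` — the REM-SOURCED part `N_j` (`N_0 = 0`, sources `r j ≤ θ₂·ρ^{2(k₀−j)}·(E·ρ^j·m₀)` — the two-block SUPS decay only like `ρ²`):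
  fed along the MASS line it keeps the decay, `n k ≤ exp(…)·θ₂E·m₀·ρ^{k+1}∕(1−ρ²)`, with NO factor `k` (the located trap: the same source fed along the `ρ⁻¹`-growing GRADIENT line
  contributes equally at every level — `ρ^{−(k−1−j)}·ρ^{2(k₀−j)}·ρ^j = ρ^{2k₀−k+1}` is `j`-independent — so `∇N_j` must be taken CRUDELY (`≤ 4d·MASS`) from this line, never fed).
HONEST SCOPE.  Elementary real analysis; the letters `ρ κ κ′ θ θ′ E` are whatever F-7b's SIGNATURE makes them (this file is shape-generic and re-cut cheaply); the T³ numerals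
(`ρ²L = 1`, windows making `θ′ρ³∕(1−ρ⁴) ≤ 1∕3`) are F-7c-2.  [folklore] bookkeeping behind [Balaban1985Averaging] Prop. 3 (122)–(126) p.36 and [Balaban1984PropagatorsI] (1.18)–(1.20).
-/

set_option autoImplicit false

noncomputable section

open scoped BigOperators

namespace Summit.QuantumFields.YangMills.Theorems.Prop7CornerCombLevelInduction

open Summit.QuantumFields.YangMills.Theorems.Prop7TrueLinSourcedDefectL1Rows (sourced_recursion_bound_init)

/-! ## §1 A scalar letter -/

/-- The top-anchored geometric sum: `Σ_{j<k} ρ^{4(k₀−j)} ≤ ρ⁴∕(1−ρ⁴)` for `0 ≤ ρ < 1`, `k ≤ k₀` (each `k₀ − j ≥ 1`; reflect and sum the geometric series). [folklore] -/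
theorem geom_sum_top_le {ρ : ℝ} (hρ0 : 0 ≤ ρ) (hρ1 : ρ < 1) {k k₀ : ℕ} (hk : k ≤ k₀) :
    ∑ j ∈ Finset.range k, ρ ^ (4 * (k₀ - j)) ≤ ρ ^ 4 / (1 - ρ ^ 4) := by
  have hρ4 : ρ ^ 4 < 1 := by
    have := pow_lt_one₀ hρ0 hρ1 (by norm_num : (4 : ℕ) ≠ 0)
    exact this
  have h1 : 0 < 1 - ρ ^ 4 := by linarith
  have hρ40 : 0 ≤ ρ ^ 4 := pow_nonneg hρ0 4
  -- termwise: `ρ^{4(k₀−j)} = ρ⁴·(ρ⁴)^{k₀−1−j} ≤ ρ⁴·(ρ⁴)^{k−1−j}`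
  have hterm : ∀ j ∈ Finset.range k, ρ ^ (4 * (k₀ - j)) ≤ ρ ^ 4 * (ρ ^ 4) ^ (k - 1 - j) := by
    intro j hj
    have hjk := Finset.mem_range.mp hj
    rw [← pow_mul, ← pow_add]
    exact pow_le_pow_of_le_one hρ0 hρ1.le (by omega)
  refine (Finset.sum_le_sum hterm).trans ?_
  rw [← Finset.mul_sum, Finset.sum_range_reflect (fun m => (ρ ^ 4) ^ m) k]
  have hgeom : ∑ m ∈ Finset.range k, (ρ ^ 4) ^ m ≤ 1 / (1 - ρ ^ 4) := by
    rw [le_div_iff₀ h1, geom_sum_mul_neg (ρ ^ 4) k]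
    have : 0 ≤ (ρ ^ 4) ^ k := pow_nonneg hρ40 k
    linarith
  calc ρ ^ 4 * ∑ m ∈ Finset.range k, (ρ ^ 4) ^ m ≤ ρ ^ 4 * (1 / (1 - ρ ^ 4)) := mul_le_mul_of_nonneg_left hgeom hρ40
    _ = ρ ^ 4 / (1 - ρ ^ 4) := by ring

/-! ## §2 ★ The mass line -/

/-- ★ **THE MASS LINE**: nonnegative `m`, `κ′` with `m (j+1) ≤ (ρ + κ′ j)·m j` for `j < k` (`ρ > 0`) ⇒ `m k ≤ exp(ρ⁻¹·Σ_{j<k} κ′ j)·ρ^k·m 0`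
(✓`sourced_recursion_bound_init` at unit slope and zero source). [folklore] -/
theorem mass_line_le {ρ : ℝ} (hρ : 0 < ρ) (κ' m : ℕ → ℝ) (hκ' : ∀ j, 0 ≤ κ' j) (hm : ∀ j, 0 ≤ m j) {k : ℕ}
    (hrec : ∀ j < k, m (j + 1) ≤ (ρ + κ' j) * m j) :
    m k ≤ Real.exp (ρ⁻¹ * ∑ j ∈ Finset.range k, κ' j) * ρ ^ k * m 0 := by
  have h := sourced_recursion_bound_init hρ zero_le_one κ' m (fun _ => 0) hκ' hm (fun _ => le_rfl) k
    (fun j hj => by have := hrec j hj; simpa using this)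
  simp only [mul_zero, Finset.sum_const_zero, add_zero] at h
  calc m k ≤ Real.exp (1 / ρ * ∑ j ∈ Finset.range k, κ' j) * (ρ ^ k * m 0) := h
    _ = _ := by rw [one_div]; ring

/-- ★ **THE MASS LINE, GEOMETRIC COEFFICIENTS**: if moreover `κ′ j ≤ θ′·ρ^{4(k₀−j)}` (`j < k ≤ k₀`, `0 < ρ < 1`, `θ′ ≥ 0`), then
`m k ≤ exp(θ′·ρ³∕(1−ρ⁴))·ρ^k·m 0`. [folklore] -/
theorem mass_line_le_geom {ρ θ' : ℝ} (hρ0 : 0 < ρ) (hρ1 : ρ < 1) (hθ' : 0 ≤ θ') (κ' m : ℕ → ℝ) (hκ' : ∀ j, 0 ≤ κ' j) (hm : ∀ j, 0 ≤ m j)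
    {k k₀ : ℕ} (hk : k ≤ k₀) (hgeo : ∀ j < k, κ' j ≤ θ' * ρ ^ (4 * (k₀ - j)))
    (hrec : ∀ j < k, m (j + 1) ≤ (ρ + κ' j) * m j) :
    m k ≤ Real.exp (θ' * (ρ ^ 3 / (1 - ρ ^ 4))) * ρ ^ k * m 0 := by
  have h := mass_line_le hρ0 κ' m hκ' hm hrec
  have hsum : ∑ j ∈ Finset.range k, κ' j ≤ θ' * (ρ ^ 4 / (1 - ρ ^ 4)) := by
    calc ∑ j ∈ Finset.range k, κ' j ≤ ∑ j ∈ Finset.range k, θ' * ρ ^ (4 * (k₀ - j)) :=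
          Finset.sum_le_sum fun j hj => hgeo j (Finset.mem_range.mp hj)
      _ = θ' * ∑ j ∈ Finset.range k, ρ ^ (4 * (k₀ - j)) := by rw [Finset.mul_sum]
      _ ≤ θ' * (ρ ^ 4 / (1 - ρ ^ 4)) := mul_le_mul_of_nonneg_left (geom_sum_top_le hρ0.le hρ1 hk) hθ'
  have hexp : Real.exp (ρ⁻¹ * ∑ j ∈ Finset.range k, κ' j) ≤ Real.exp (θ' * (ρ ^ 3 / (1 - ρ ^ 4))) := by
    apply Real.exp_le_exp.mpr
    have h4 : ρ ^ 4 < 1 := pow_lt_one₀ hρ0.le hρ1 (by norm_num)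
    have h1 : 0 < 1 - ρ ^ 4 := by linarith
    calc ρ⁻¹ * ∑ j ∈ Finset.range k, κ' j ≤ ρ⁻¹ * (θ' * (ρ ^ 4 / (1 - ρ ^ 4))) :=
          mul_le_mul_of_nonneg_left hsum (inv_nonneg.mpr hρ0.le)
      _ = θ' * (ρ ^ 3 / (1 - ρ ^ 4)) := by field_simp
  have h0 : 0 ≤ ρ ^ k * m 0 := mul_nonneg (pow_nonneg hρ0.le _) (hm 0)
  calc m k ≤ Real.exp (ρ⁻¹ * ∑ j ∈ Finset.range k, κ' j) * ρ ^ k * m 0 := h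
    _ = Real.exp (ρ⁻¹ * ∑ j ∈ Finset.range k, κ' j) * (ρ ^ k * m 0) := by ring
    _ ≤ Real.exp (θ' * (ρ ^ 3 / (1 - ρ ^ 4))) * (ρ ^ k * m 0) := mul_le_mul_of_nonneg_right hexp h0
    _ = _ := by ring

/-! ## §3 ★★ The gradient line with the mass feed -/

/-- ★ **THE GRADIENT LINE**: nonnegative `g`, `κ`, `m` with `g (j+1) ≤ ρ_g·g j + κ j·m j` for `j < k` (`ρ_g > 0`) ⇒
`g k ≤ ρ_g^k·g 0 + Σ_{j<k} ρ_g^{k−1−j}·(κ j·m j)` (✓`sourced_recursion_bound_init` at zero slope perturbation, source `κ j·m j`). [folklore] -/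
theorem grad_line_le {ρg : ℝ} (hρg : 0 < ρg) (κ g m : ℕ → ℝ) (hκ : ∀ j, 0 ≤ κ j) (hg : ∀ j, 0 ≤ g j) (hm : ∀ j, 0 ≤ m j) {k : ℕ}
    (hrec : ∀ j < k, g (j + 1) ≤ ρg * g j + κ j * m j) :
    g k ≤ ρg ^ k * g 0 + ∑ j ∈ Finset.range k, ρg ^ (k - 1 - j) * (κ j * m j) := by
  have h := sourced_recursion_bound_init hρg le_rfl (fun _ => 0) g (fun j => κ j * m j) (fun _ => le_rfl) hg
    (fun j => mul_nonneg (hκ j) (hm j)) k (fun j hj => by have := hrec j hj; simpa using this)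
  simpa using h

/-- The exponent bookkeeping of the feed at `ρ_g = ρ⁻¹`: `(ρ⁻¹)^{k−1−j}·ρ^j·ρ^{4(k₀−j)} ≤ ρ^{k+3}·(ρ²)^{k−1−j}` for `j < k ≤ k₀`, `0 < ρ ≤ 1`
(`4k₀ − k + 1 − 2j ≥ 3k + 1 − 2j`). [folklore] -/
theorem inv_pow_mul_pow_le {ρ : ℝ} (hρ0 : 0 < ρ) (hρ1 : ρ ≤ 1) {j k k₀ : ℕ} (hjk : j < k) (hk : k ≤ k₀) :
    (ρ⁻¹) ^ (k - 1 - j) * ρ ^ j * ρ ^ (4 * (k₀ - j)) ≤ ρ ^ (k + 3) * (ρ ^ 2) ^ (k - 1 - j) := by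
  -- `ρ^j·ρ^{4(k₀−j)} = ρ^{k−1−j}·ρ^{4k₀−k+1−2j}`
  have hsplit : ρ ^ j * ρ ^ (4 * (k₀ - j)) = ρ ^ (k - 1 - j) * ρ ^ (4 * k₀ - k + 1 - 2 * j) := by
    rw [← pow_add, ← pow_add]; congr 1; omega
  have hne : (ρ⁻¹) ^ (k - 1 - j) * ρ ^ (k - 1 - j) = 1 := by
    rw [← mul_pow, inv_mul_cancel₀ hρ0.ne', one_pow]
  calc (ρ⁻¹) ^ (k - 1 - j) * ρ ^ j * ρ ^ (4 * (k₀ - j))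
      = ((ρ⁻¹) ^ (k - 1 - j) * ρ ^ (k - 1 - j)) * ρ ^ (4 * k₀ - k + 1 - 2 * j) := by rw [mul_assoc, hsplit, ← mul_assoc]
    _ = ρ ^ (4 * k₀ - k + 1 - 2 * j) := by rw [hne, one_mul]
    _ ≤ ρ ^ (k + 3 + 2 * (k - 1 - j)) := pow_le_pow_of_le_one hρ0.le hρ1 (by omega)
    _ = ρ ^ (k + 3) * (ρ ^ 2) ^ (k - 1 - j) := by rw [pow_add, pow_mul]

/-- ★★ **THE FEED SUM** (d = 3 letters `ρ_g = ρ⁻¹`): with `κ j ≤ θ·ρ^{4(k₀−j)}` and `m j ≤ E·ρ^j·m 0` for `j < k ≤ k₀` (`0 < ρ < 1`, `θ, E, m 0 ≥ 0`),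
`Σ_{j<k} (ρ⁻¹)^{k−1−j}·(κ j·m j) ≤ θ·E·m 0·(ρ^{k+3}∕(1−ρ²))` — the mass fed into the gradients keeps the decay `ρ^k` of the mass line. [folklore] -/
theorem feed_sum_le {ρ θ E : ℝ} (hρ0 : 0 < ρ) (hρ1 : ρ < 1) (hθ : 0 ≤ θ) (hE : 0 ≤ E) (κ m : ℕ → ℝ)
    (hm : ∀ j, 0 ≤ m j) {k k₀ : ℕ} (hk : k ≤ k₀) (hκgeo : ∀ j < k, κ j ≤ θ * ρ ^ (4 * (k₀ - j)))
    (hmass : ∀ j < k, m j ≤ E * ρ ^ j * m 0) :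
    ∑ j ∈ Finset.range k, (ρ⁻¹) ^ (k - 1 - j) * (κ j * m j) ≤ θ * E * m 0 * (ρ ^ (k + 3) / (1 - ρ ^ 2)) := by
  have hρ2 : ρ ^ 2 < 1 := pow_lt_one₀ hρ0.le hρ1 (by norm_num)
  have h1 : 0 < 1 - ρ ^ 2 := by linarith
  have hρ20 : 0 ≤ ρ ^ 2 := sq_nonneg ρ
  have hterm : ∀ j ∈ Finset.range k, (ρ⁻¹) ^ (k - 1 - j) * (κ j * m j) ≤ θ * E * m 0 * (ρ ^ (k + 3) * (ρ ^ 2) ^ (k - 1 - j)) := by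
    intro j hj
    have hjk := Finset.mem_range.mp hj
    have hi0 : 0 ≤ (ρ⁻¹) ^ (k - 1 - j) := pow_nonneg (inv_nonneg.mpr hρ0.le) _
    calc (ρ⁻¹) ^ (k - 1 - j) * (κ j * m j) ≤ (ρ⁻¹) ^ (k - 1 - j) * ((θ * ρ ^ (4 * (k₀ - j))) * (E * ρ ^ j * m 0)) :=
          mul_le_mul_of_nonneg_left (mul_le_mul (hκgeo j hjk) (hmass j hjk) (hm j) (by positivity)) hi0
      _ = θ * E * m 0 * ((ρ⁻¹) ^ (k - 1 - j) * ρ ^ j * ρ ^ (4 * (k₀ - j))) := by ring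
      _ ≤ θ * E * m 0 * (ρ ^ (k + 3) * (ρ ^ 2) ^ (k - 1 - j)) :=
          mul_le_mul_of_nonneg_left (inv_pow_mul_pow_le hρ0 hρ1.le hjk hk) (by have := hm 0; positivity)
  refine (Finset.sum_le_sum hterm).trans ?_
  rw [← Finset.mul_sum, ← Finset.mul_sum, Finset.sum_range_reflect (fun i => (ρ ^ 2) ^ i) k]
  have hgeom : ∑ i ∈ Finset.range k, (ρ ^ 2) ^ i ≤ 1 / (1 - ρ ^ 2) := by
    rw [le_div_iff₀ h1, geom_sum_mul_neg (ρ ^ 2) k]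
    have : 0 ≤ (ρ ^ 2) ^ k := pow_nonneg hρ20 k
    linarith
  have h0 : 0 ≤ θ * E * m 0 * ρ ^ (k + 3) := by have := hm 0; positivity
  calc θ * E * m 0 * (ρ ^ (k + 3) * ∑ i ∈ Finset.range k, (ρ ^ 2) ^ i)
      = (θ * E * m 0 * ρ ^ (k + 3)) * ∑ i ∈ Finset.range k, (ρ ^ 2) ^ i := by ring
    _ ≤ (θ * E * m 0 * ρ ^ (k + 3)) * (1 / (1 - ρ ^ 2)) := mul_le_mul_of_nonneg_left hgeom h0
    _ = _ := by ring

/-- ★★★ **THE TWO LINES TOGETHER** (d = 3 letters): mass line `m (j+1) ≤ (ρ + κ′ j)·m j` with `κ′ j ≤ θ′·ρ^{4(k₀−j)}`, gradient line `g (j+1) ≤ ρ⁻¹·g j + κ j·m j` with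
`κ j ≤ θ·ρ^{4(k₀−j)}`, all for `j < k₀`; then for every `k ≤ k₀`:
`g k ≤ (ρ⁻¹)^k·g 0 + θ·exp(θ′ρ³∕(1−ρ⁴))·m 0·(ρ^{k+3}∕(1−ρ²))`. [folklore] -/
theorem grad_line_le_geom {ρ θ θ' : ℝ} (hρ0 : 0 < ρ) (hρ1 : ρ < 1) (hθ : 0 ≤ θ) (hθ' : 0 ≤ θ') (κ κ' g m : ℕ → ℝ)
    (hκ : ∀ j, 0 ≤ κ j) (hκ' : ∀ j, 0 ≤ κ' j) (hg : ∀ j, 0 ≤ g j) (hm : ∀ j, 0 ≤ m j) {k₀ : ℕ}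
    (hκgeo : ∀ j < k₀, κ j ≤ θ * ρ ^ (4 * (k₀ - j))) (hκ'geo : ∀ j < k₀, κ' j ≤ θ' * ρ ^ (4 * (k₀ - j)))
    (hmrec : ∀ j < k₀, m (j + 1) ≤ (ρ + κ' j) * m j) (hgrec : ∀ j < k₀, g (j + 1) ≤ ρ⁻¹ * g j + κ j * m j) {k : ℕ} (hk : k ≤ k₀) :
    g k ≤ (ρ⁻¹) ^ k * g 0 + θ * Real.exp (θ' * (ρ ^ 3 / (1 - ρ ^ 4))) * m 0 * (ρ ^ (k + 3) / (1 - ρ ^ 2)) := by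
  have hmass : ∀ j < k, m j ≤ Real.exp (θ' * (ρ ^ 3 / (1 - ρ ^ 4))) * ρ ^ j * m 0 := fun j hj =>
    mass_line_le_geom hρ0 hρ1 hθ' κ' m hκ' hm (show j ≤ k₀ by omega) (fun i hi => hκ'geo i (by omega)) (fun i hi => hmrec i (by omega))
  have hfeed := feed_sum_le hρ0 hρ1 hθ (Real.exp_pos _).le κ m hm hk (fun j hj => hκgeo j (by omega)) hmass
  have hgl := grad_line_le (inv_pos.mpr hρ0) κ g m hκ hg hm (k := k) (fun j hj => hgrec j (by omega))
  calc g k ≤ (ρ⁻¹) ^ k * g 0 + ∑ j ∈ Finset.range k, (ρ⁻¹) ^ (k - 1 - j) * (κ j * m j) := hgl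
    _ ≤ (ρ⁻¹) ^ k * g 0 + θ * Real.exp (θ' * (ρ ^ 3 / (1 - ρ ^ 4))) * m 0 * (ρ ^ (k + 3) / (1 - ρ ^ 2)) := by linarith

/-! ## §4 The squared forms (what a Σ‖·‖² knit consumes) -/

/-- ★ **MASS LINE, SQUARED**: under the hypotheses of `mass_line_le_geom`, `m k² ≤ exp(2θ′ρ³∕(1−ρ⁴))·(ρ²)^k·m 0²` — at `ρ² = L⁻¹` the A-slot decay `(Lᵏ)⁻¹`. [folklore] -/
theorem mass_line_sq_le_geom {ρ θ' : ℝ} (hρ0 : 0 < ρ) (hρ1 : ρ < 1) (hθ' : 0 ≤ θ') (κ' m : ℕ → ℝ) (hκ' : ∀ j, 0 ≤ κ' j) (hm : ∀ j, 0 ≤ m j)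
    {k k₀ : ℕ} (hk : k ≤ k₀) (hgeo : ∀ j < k, κ' j ≤ θ' * ρ ^ (4 * (k₀ - j)))
    (hrec : ∀ j < k, m (j + 1) ≤ (ρ + κ' j) * m j) :
    m k ^ 2 ≤ Real.exp (2 * (θ' * (ρ ^ 3 / (1 - ρ ^ 4)))) * (ρ ^ 2) ^ k * m 0 ^ 2 := by
  have h := mass_line_le_geom hρ0 hρ1 hθ' κ' m hκ' hm hk hgeo hrec
  have h2 := pow_le_pow_left₀ (hm k) h 2
  calc m k ^ 2 ≤ (Real.exp (θ' * (ρ ^ 3 / (1 - ρ ^ 4))) * ρ ^ k * m 0) ^ 2 := h2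
    _ = Real.exp (2 * (θ' * (ρ ^ 3 / (1 - ρ ^ 4)))) * (ρ ^ 2) ^ k * m 0 ^ 2 := by
        rw [mul_pow, mul_pow, ← Real.exp_nat_mul, ← pow_mul, ← pow_mul, mul_comm k 2]; push_cast; ring

/-- ★ **GRADIENT LINE, SQUARED**: under the hypotheses of `grad_line_le_geom`, for `k ≤ k₀`,
`g k² ≤ 2·((ρ⁻¹)^k)²·g 0² + 2·θ²·exp(2θ′ρ³∕(1−ρ⁴))·m 0²·(ρ^{k+3}∕(1−ρ²))²` — at `ρ² = L⁻¹`: `Lᵏ·g 0²` (B-slot) plus `θ²·L^{−k−3}∕(1−L⁻¹)²·m 0²` (A-slot). [folklore] -/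
theorem grad_line_sq_le_geom {ρ θ θ' : ℝ} (hρ0 : 0 < ρ) (hρ1 : ρ < 1) (hθ : 0 ≤ θ) (hθ' : 0 ≤ θ') (κ κ' g m : ℕ → ℝ)
    (hκ : ∀ j, 0 ≤ κ j) (hκ' : ∀ j, 0 ≤ κ' j) (hg : ∀ j, 0 ≤ g j) (hm : ∀ j, 0 ≤ m j) {k₀ : ℕ}
    (hκgeo : ∀ j < k₀, κ j ≤ θ * ρ ^ (4 * (k₀ - j))) (hκ'geo : ∀ j < k₀, κ' j ≤ θ' * ρ ^ (4 * (k₀ - j)))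
    (hmrec : ∀ j < k₀, m (j + 1) ≤ (ρ + κ' j) * m j) (hgrec : ∀ j < k₀, g (j + 1) ≤ ρ⁻¹ * g j + κ j * m j) {k : ℕ} (hk : k ≤ k₀) :
    g k ^ 2 ≤ 2 * ((ρ⁻¹) ^ k) ^ 2 * g 0 ^ 2
      + 2 * θ ^ 2 * Real.exp (2 * (θ' * (ρ ^ 3 / (1 - ρ ^ 4)))) * m 0 ^ 2 * (ρ ^ (k + 3) / (1 - ρ ^ 2)) ^ 2 := by
  have h := grad_line_le_geom hρ0 hρ1 hθ hθ' κ κ' g m hκ hκ' hg hm hκgeo hκ'geo hmrec hgrec hk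
  have h2 := pow_le_pow_left₀ (hg k) h 2
  have sq_add_le : ∀ a b : ℝ, (a + b) ^ 2 ≤ 2 * a ^ 2 + 2 * b ^ 2 := fun a b => by nlinarith [sq_nonneg (a - b)]
  refine h2.trans ((sq_add_le _ _).trans (le_of_eq ?_))
  rw [mul_pow, mul_pow, mul_pow, mul_pow, ← Real.exp_nat_mul]
  push_cast
  ring

/-! ## §5 ★★ The rem-sourced part with zero initial datum (sources decaying only like `ρ^{2(k₀−j)}` — the two-block sups `μ_j`) -/

/-- The exponent bookkeeping of a `ρ²`-geometric source fed along the MASS line: `ρ^{k−1−j}·ρ^{2(k₀−j)}·ρ^j ≤ ρ^{k+1}·(ρ²)^{k−1−j}` for `j < k ≤ k₀`, `0 ≤ ρ ≤ 1`. [folklore] -/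
theorem pow_mul_pow_mul_pow_le {ρ : ℝ} (hρ0 : 0 ≤ ρ) (hρ1 : ρ ≤ 1) {j k k₀ : ℕ} (hjk : j < k) (hk : k ≤ k₀) :
    ρ ^ (k - 1 - j) * ρ ^ (2 * (k₀ - j)) * ρ ^ j ≤ ρ ^ (k + 1) * (ρ ^ 2) ^ (k - 1 - j) := by
  rw [← pow_add, ← pow_add, ← pow_mul, ← pow_add]
  exact pow_le_pow_of_le_one hρ0 hρ1 (by omega)

/-- ★★ **THE SOURCED MASS LINE WITH `ρ²`-GEOMETRIC SOURCES** (the nonlinear-remainder part `N_j` of the tower, `N_0 = 0`): nonnegative `n`, `κ′`, `r` with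
`n 0 = 0`, `n (j+1) ≤ (ρ + κ′ j)·n j + r j`, `κ′ j ≤ θ′·ρ^{4(k₀−j)}` and `r j ≤ θ₂·ρ^{2(k₀−j)}·(E·ρ^j·m₀)` for `j < k ≤ k₀` (`0 < ρ < 1`) ⇒
`n k ≤ exp(θ′ρ³∕(1−ρ⁴))·θ₂·E·m₀·(ρ^{k+1}∕(1−ρ²))` — the SAME decay as the sourceless mass line, NO factor `k`: along the mass line (`ρ`-CONTRACTING) a `ρ²`-geometric source is
dominated by its top term; fed instead along the `ρ⁻¹`-GROWING gradient line (`feed_sum_le` with `ρ^{2(k₀−j)}` in place of `ρ^{4(k₀−j)}`) every level would contribute equally and a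
factor `k = #levels` would appear — so the crude gradient of the nonlinear remainder belongs here (`GRAD ≤ 4d·MASS` of `N_j`), not in the gradient line. [folklore] -/
theorem sourced_line_le_geom {ρ θ' θ₂ E m₀ : ℝ} (hρ0 : 0 < ρ) (hρ1 : ρ < 1) (hθ' : 0 ≤ θ') (hθ₂ : 0 ≤ θ₂) (hE : 0 ≤ E) (hm₀ : 0 ≤ m₀)
    (κ' n r : ℕ → ℝ) (hκ' : ∀ j, 0 ≤ κ' j) (hn : ∀ j, 0 ≤ n j) (hr : ∀ j, 0 ≤ r j) (hn0 : n 0 = 0) {k k₀ : ℕ} (hk : k ≤ k₀)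
    (hgeo : ∀ j < k, κ' j ≤ θ' * ρ ^ (4 * (k₀ - j))) (hrgeo : ∀ j < k, r j ≤ θ₂ * ρ ^ (2 * (k₀ - j)) * (E * ρ ^ j * m₀))
    (hrec : ∀ j < k, n (j + 1) ≤ (ρ + κ' j) * n j + r j) :
    n k ≤ Real.exp (θ' * (ρ ^ 3 / (1 - ρ ^ 4))) * (θ₂ * E * m₀ * (ρ ^ (k + 1) / (1 - ρ ^ 2))) := by
  have hρ2 : ρ ^ 2 < 1 := pow_lt_one₀ hρ0.le hρ1 (by norm_num)
  have h12 : 0 < 1 - ρ ^ 2 := by linarith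
  have hρ4 : ρ ^ 4 < 1 := pow_lt_one₀ hρ0.le hρ1 (by norm_num)
  have h14 : 0 < 1 - ρ ^ 4 := by linarith
  -- the generic sourced recursion at unit slope
  have h := sourced_recursion_bound_init hρ0 zero_le_one κ' n r hκ' hn hr k (fun j hj => by have := hrec j hj; simpa using this)
  rw [hn0, mul_zero, zero_add] at h
  -- the exponential factor
  have hsum : ∑ j ∈ Finset.range k, κ' j ≤ θ' * (ρ ^ 4 / (1 - ρ ^ 4)) := by
    calc ∑ j ∈ Finset.range k, κ' j ≤ ∑ j ∈ Finset.range k, θ' * ρ ^ (4 * (k₀ - j)) :=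
          Finset.sum_le_sum fun j hj => hgeo j (Finset.mem_range.mp hj)
      _ = θ' * ∑ j ∈ Finset.range k, ρ ^ (4 * (k₀ - j)) := by rw [Finset.mul_sum]
      _ ≤ θ' * (ρ ^ 4 / (1 - ρ ^ 4)) := mul_le_mul_of_nonneg_left (geom_sum_top_le hρ0.le hρ1 hk) hθ'
  have hexp : Real.exp (1 / ρ * ∑ j ∈ Finset.range k, κ' j) ≤ Real.exp (θ' * (ρ ^ 3 / (1 - ρ ^ 4))) := by
    apply Real.exp_le_exp.mpr
    calc 1 / ρ * ∑ j ∈ Finset.range k, κ' j ≤ 1 / ρ * (θ' * (ρ ^ 4 / (1 - ρ ^ 4))) :=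
          mul_le_mul_of_nonneg_left hsum (by positivity)
      _ = θ' * (ρ ^ 3 / (1 - ρ ^ 4)) := by field_simp
  -- the weighted source sum
  have hterm : ∀ j ∈ Finset.range k, ρ ^ (k - 1 - j) * r j ≤ θ₂ * E * m₀ * (ρ ^ (k + 1) * (ρ ^ 2) ^ (k - 1 - j)) := by
    intro j hj
    have hjk := Finset.mem_range.mp hj
    calc ρ ^ (k - 1 - j) * r j ≤ ρ ^ (k - 1 - j) * (θ₂ * ρ ^ (2 * (k₀ - j)) * (E * ρ ^ j * m₀)) :=
          mul_le_mul_of_nonneg_left (hrgeo j hjk) (pow_nonneg hρ0.le _)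
      _ = θ₂ * E * m₀ * (ρ ^ (k - 1 - j) * ρ ^ (2 * (k₀ - j)) * ρ ^ j) := by ring
      _ ≤ θ₂ * E * m₀ * (ρ ^ (k + 1) * (ρ ^ 2) ^ (k - 1 - j)) :=
          mul_le_mul_of_nonneg_left (pow_mul_pow_mul_pow_le hρ0.le hρ1.le hjk hk) (by positivity)
  have hS : ∑ j ∈ Finset.range k, ρ ^ (k - 1 - j) * r j ≤ θ₂ * E * m₀ * (ρ ^ (k + 1) / (1 - ρ ^ 2)) := by
    refine (Finset.sum_le_sum hterm).trans ?_
    rw [← Finset.mul_sum, ← Finset.mul_sum, Finset.sum_range_reflect (fun i => (ρ ^ 2) ^ i) k]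
    have hgeom : ∑ i ∈ Finset.range k, (ρ ^ 2) ^ i ≤ 1 / (1 - ρ ^ 2) := by
      rw [le_div_iff₀ h12, geom_sum_mul_neg (ρ ^ 2) k]
      have : 0 ≤ (ρ ^ 2) ^ k := pow_nonneg (sq_nonneg ρ) k
      linarith
    have h0 : 0 ≤ θ₂ * E * m₀ * ρ ^ (k + 1) := by positivity
    calc θ₂ * E * m₀ * (ρ ^ (k + 1) * ∑ i ∈ Finset.range k, (ρ ^ 2) ^ i)
        = (θ₂ * E * m₀ * ρ ^ (k + 1)) * ∑ i ∈ Finset.range k, (ρ ^ 2) ^ i := by ring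
      _ ≤ (θ₂ * E * m₀ * ρ ^ (k + 1)) * (1 / (1 - ρ ^ 2)) := mul_le_mul_of_nonneg_left hgeom h0
      _ = _ := by ring
  have hS0 : 0 ≤ ∑ j ∈ Finset.range k, ρ ^ (k - 1 - j) * r j := Finset.sum_nonneg fun j _ => mul_nonneg (pow_nonneg hρ0.le _) (hr j)
  calc n k ≤ Real.exp (1 / ρ * ∑ j ∈ Finset.range k, κ' j) * ∑ j ∈ Finset.range k, ρ ^ (k - 1 - j) * r j := h
    _ ≤ Real.exp (θ' * (ρ ^ 3 / (1 - ρ ^ 4))) * (θ₂ * E * m₀ * (ρ ^ (k + 1) / (1 - ρ ^ 2))) :=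
        mul_le_mul hexp hS hS0 (Real.exp_pos _).le

/-! ## §6 ★★★ THE SHARP FORMS (keep the top-anchored decay `ρ^{4(k₀−k)}` ∕ `ρ^{2(k₀−k)}` — needed when F-6d re-weights the LOWER levels `i < j` with GROWING weights `(√L)^{j−1−i}`)
§3's `ρ^{k+3}` and §5's `ρ^{k+1}` are the TOP-LEVEL shapes (`k = k₀`); at a lower level `k` the feed of the sourceless gradient line is really `ρ^{4k₀−3k+3}∕(1−ρ²)` (shape `(ρ⁻¹)^{3k}` with the tiny
coefficient `ρ^{4k₀+3}`) and the rem-sourced line `ρ^{2k₀−k+1}∕(1−ρ²)` (shape `(ρ⁻¹)^k` with coefficient `ρ^{2k₀+1}`); squared and re-weighted by `(√L)^{j−1−k} = (ρ⁻¹)^{j−1−k}` over `k < j`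
these stay A-slot (`ρ^{8k₀−6j+12} ≤ ρ^{2j}·ρ^{12}`, `ρ^{4k₀−2j+…} ≤ ρ^{2j}·…` for `j ≤ k₀`), whereas the top-level shapes would not.  Same proofs, one `pow_le_pow` fewer. -/

/-- The exact exponent bookkeeping of the sourceless gradient feed: `(ρ⁻¹)^{k−1−j}·ρ^j·ρ^{4(k₀−j)} = ρ^{(4k₀+3−3k) + 2(k−1−j)}` (`j < k ≤ k₀`). [folklore] -/
theorem inv_pow_mul_pow_eq_sharp {ρ : ℝ} (hρ0 : 0 < ρ) {j k k₀ : ℕ} (hjk : j < k) (hk : k ≤ k₀) :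
    (ρ⁻¹) ^ (k - 1 - j) * ρ ^ j * ρ ^ (4 * (k₀ - j)) = ρ ^ (4 * k₀ + 3 - 3 * k) * (ρ ^ 2) ^ (k - 1 - j) := by
  have hsplit : ρ ^ j * ρ ^ (4 * (k₀ - j)) = ρ ^ (k - 1 - j) * ρ ^ ((4 * k₀ + 3 - 3 * k) + 2 * (k - 1 - j)) := by
    rw [← pow_add, ← pow_add]; congr 1; omega
  have hne : (ρ⁻¹) ^ (k - 1 - j) * ρ ^ (k - 1 - j) = 1 := by
    rw [← mul_pow, inv_mul_cancel₀ hρ0.ne', one_pow]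
  calc (ρ⁻¹) ^ (k - 1 - j) * ρ ^ j * ρ ^ (4 * (k₀ - j))
      = ((ρ⁻¹) ^ (k - 1 - j) * ρ ^ (k - 1 - j)) * ρ ^ ((4 * k₀ + 3 - 3 * k) + 2 * (k - 1 - j)) := by rw [mul_assoc, hsplit, ← mul_assoc]
    _ = ρ ^ (4 * k₀ + 3 - 3 * k) * (ρ ^ 2) ^ (k - 1 - j) := by rw [hne, one_mul, pow_add, pow_mul]

/-- ★★★ **THE FEED SUM, SHARP**: under `feed_sum_le`'s hypotheses, `Σ_{j<k} (ρ⁻¹)^{k−1−j}·(κ j·m j) ≤ θ·E·m 0·(ρ^{4k₀+3−3k}∕(1−ρ²))` (`k ≤ k₀`). [folklore] -/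
theorem feed_sum_le_sharp {ρ θ E : ℝ} (hρ0 : 0 < ρ) (hρ1 : ρ < 1) (hθ : 0 ≤ θ) (hE : 0 ≤ E) (κ m : ℕ → ℝ)
    (hm : ∀ j, 0 ≤ m j) {k k₀ : ℕ} (hk : k ≤ k₀) (hκgeo : ∀ j < k, κ j ≤ θ * ρ ^ (4 * (k₀ - j)))
    (hmass : ∀ j < k, m j ≤ E * ρ ^ j * m 0) :
    ∑ j ∈ Finset.range k, (ρ⁻¹) ^ (k - 1 - j) * (κ j * m j) ≤ θ * E * m 0 * (ρ ^ (4 * k₀ + 3 - 3 * k) / (1 - ρ ^ 2)) := by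
  have hρ2 : ρ ^ 2 < 1 := pow_lt_one₀ hρ0.le hρ1 (by norm_num)
  have h1 : 0 < 1 - ρ ^ 2 := by linarith
  have hρ20 : 0 ≤ ρ ^ 2 := sq_nonneg ρ
  have hterm : ∀ j ∈ Finset.range k, (ρ⁻¹) ^ (k - 1 - j) * (κ j * m j) ≤ θ * E * m 0 * (ρ ^ (4 * k₀ + 3 - 3 * k) * (ρ ^ 2) ^ (k - 1 - j)) := by
    intro j hj
    have hjk := Finset.mem_range.mp hj
    have hi0 : 0 ≤ (ρ⁻¹) ^ (k - 1 - j) := pow_nonneg (inv_nonneg.mpr hρ0.le) _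
    calc (ρ⁻¹) ^ (k - 1 - j) * (κ j * m j) ≤ (ρ⁻¹) ^ (k - 1 - j) * ((θ * ρ ^ (4 * (k₀ - j))) * (E * ρ ^ j * m 0)) :=
          mul_le_mul_of_nonneg_left (mul_le_mul (hκgeo j hjk) (hmass j hjk) (hm j) (by positivity)) hi0
      _ = θ * E * m 0 * ((ρ⁻¹) ^ (k - 1 - j) * ρ ^ j * ρ ^ (4 * (k₀ - j))) := by ring
      _ = θ * E * m 0 * (ρ ^ (4 * k₀ + 3 - 3 * k) * (ρ ^ 2) ^ (k - 1 - j)) := by rw [inv_pow_mul_pow_eq_sharp hρ0 hjk hk]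
  refine (Finset.sum_le_sum hterm).trans ?_
  rw [← Finset.mul_sum, ← Finset.mul_sum, Finset.sum_range_reflect (fun i => (ρ ^ 2) ^ i) k]
  have hgeom : ∑ i ∈ Finset.range k, (ρ ^ 2) ^ i ≤ 1 / (1 - ρ ^ 2) := by
    rw [le_div_iff₀ h1, geom_sum_mul_neg (ρ ^ 2) k]
    have : 0 ≤ (ρ ^ 2) ^ k := pow_nonneg hρ20 k
    linarith
  have h0 : 0 ≤ θ * E * m 0 * ρ ^ (4 * k₀ + 3 - 3 * k) := by have := hm 0; positivity
  calc θ * E * m 0 * (ρ ^ (4 * k₀ + 3 - 3 * k) * ∑ i ∈ Finset.range k, (ρ ^ 2) ^ i)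
      = (θ * E * m 0 * ρ ^ (4 * k₀ + 3 - 3 * k)) * ∑ i ∈ Finset.range k, (ρ ^ 2) ^ i := by ring
    _ ≤ (θ * E * m 0 * ρ ^ (4 * k₀ + 3 - 3 * k)) * (1 / (1 - ρ ^ 2)) := mul_le_mul_of_nonneg_left hgeom h0
    _ = _ := by ring

/-- ★★★ **THE TWO LINES TOGETHER, SHARP**: under `grad_line_le_geom`'s hypotheses, for every `k ≤ k₀`:
`g k ≤ (ρ⁻¹)^k·g 0 + θ·exp(θ′ρ³∕(1−ρ⁴))·m 0·(ρ^{4k₀+3−3k}∕(1−ρ²))`. [folklore] -/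
theorem grad_line_le_geom_sharp {ρ θ θ' : ℝ} (hρ0 : 0 < ρ) (hρ1 : ρ < 1) (hθ : 0 ≤ θ) (hθ' : 0 ≤ θ') (κ κ' g m : ℕ → ℝ)
    (hκ : ∀ j, 0 ≤ κ j) (hκ' : ∀ j, 0 ≤ κ' j) (hg : ∀ j, 0 ≤ g j) (hm : ∀ j, 0 ≤ m j) {k₀ : ℕ}
    (hκgeo : ∀ j < k₀, κ j ≤ θ * ρ ^ (4 * (k₀ - j))) (hκ'geo : ∀ j < k₀, κ' j ≤ θ' * ρ ^ (4 * (k₀ - j)))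
    (hmrec : ∀ j < k₀, m (j + 1) ≤ (ρ + κ' j) * m j) (hgrec : ∀ j < k₀, g (j + 1) ≤ ρ⁻¹ * g j + κ j * m j) {k : ℕ} (hk : k ≤ k₀) :
    g k ≤ (ρ⁻¹) ^ k * g 0 + θ * Real.exp (θ' * (ρ ^ 3 / (1 - ρ ^ 4))) * m 0 * (ρ ^ (4 * k₀ + 3 - 3 * k) / (1 - ρ ^ 2)) := by
  have hmass : ∀ j < k, m j ≤ Real.exp (θ' * (ρ ^ 3 / (1 - ρ ^ 4))) * ρ ^ j * m 0 := fun j hj =>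
    mass_line_le_geom hρ0 hρ1 hθ' κ' m hκ' hm (show j ≤ k₀ by omega) (fun i hi => hκ'geo i (by omega)) (fun i hi => hmrec i (by omega))
  have hfeed := feed_sum_le_sharp hρ0 hρ1 hθ (Real.exp_pos _).le κ m hm hk (fun j hj => hκgeo j (by omega)) hmass
  have hgl := grad_line_le (inv_pos.mpr hρ0) κ g m hκ hg hm (k := k) (fun j hj => hgrec j (by omega))
  calc g k ≤ (ρ⁻¹) ^ k * g 0 + ∑ j ∈ Finset.range k, (ρ⁻¹) ^ (k - 1 - j) * (κ j * m j) := hgl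
    _ ≤ _ := by linarith

/-- The exact exponent bookkeeping of a `ρ²`-geometric source fed along the mass line: `ρ^{k−1−j}·ρ^{2(k₀−j)}·ρ^j = ρ^{(2k₀+1−k) + 2(k−1−j)}` (`j < k ≤ k₀`). [folklore] -/
theorem pow_mul_pow_mul_pow_eq_sharp (ρ : ℝ) {j k k₀ : ℕ} (hjk : j < k) (hk : k ≤ k₀) :
    ρ ^ (k - 1 - j) * ρ ^ (2 * (k₀ - j)) * ρ ^ j = ρ ^ (2 * k₀ + 1 - k) * (ρ ^ 2) ^ (k - 1 - j) := by
  rw [← pow_add, ← pow_add, ← pow_mul, ← pow_add]; congr 1; omega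

/-- ★★★ **THE REM-SOURCED LINE, SHARP**: under `sourced_line_le_geom`'s hypotheses, `n k ≤ exp(θ′ρ³∕(1−ρ⁴))·θ₂·E·m₀·(ρ^{2k₀+1−k}∕(1−ρ²))` (`k ≤ k₀`) —
the B-shape `(ρ⁻¹)^k` with the tiny coefficient `ρ^{2k₀+1}` (the source's `ρ^{2(k₀−j)}` is kept, not spent). [folklore] -/
theorem sourced_line_le_geom_sharp {ρ θ' θ₂ E m₀ : ℝ} (hρ0 : 0 < ρ) (hρ1 : ρ < 1) (hθ' : 0 ≤ θ') (hθ₂ : 0 ≤ θ₂) (hE : 0 ≤ E) (hm₀ : 0 ≤ m₀)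
    (κ' n r : ℕ → ℝ) (hκ' : ∀ j, 0 ≤ κ' j) (hn : ∀ j, 0 ≤ n j) (hr : ∀ j, 0 ≤ r j) (hn0 : n 0 = 0) {k k₀ : ℕ} (hk : k ≤ k₀)
    (hgeo : ∀ j < k, κ' j ≤ θ' * ρ ^ (4 * (k₀ - j))) (hrgeo : ∀ j < k, r j ≤ θ₂ * ρ ^ (2 * (k₀ - j)) * (E * ρ ^ j * m₀))
    (hrec : ∀ j < k, n (j + 1) ≤ (ρ + κ' j) * n j + r j) :
    n k ≤ Real.exp (θ' * (ρ ^ 3 / (1 - ρ ^ 4))) * (θ₂ * E * m₀ * (ρ ^ (2 * k₀ + 1 - k) / (1 - ρ ^ 2))) := by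
  have hρ2 : ρ ^ 2 < 1 := pow_lt_one₀ hρ0.le hρ1 (by norm_num)
  have h12 : 0 < 1 - ρ ^ 2 := by linarith
  have hρ4 : ρ ^ 4 < 1 := pow_lt_one₀ hρ0.le hρ1 (by norm_num)
  have h14 : 0 < 1 - ρ ^ 4 := by linarith
  have h := sourced_recursion_bound_init hρ0 zero_le_one κ' n r hκ' hn hr k (fun j hj => by have := hrec j hj; simpa using this)
  rw [hn0, mul_zero, zero_add] at h
  have hsum : ∑ j ∈ Finset.range k, κ' j ≤ θ' * (ρ ^ 4 / (1 - ρ ^ 4)) := by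
    calc ∑ j ∈ Finset.range k, κ' j ≤ ∑ j ∈ Finset.range k, θ' * ρ ^ (4 * (k₀ - j)) :=
          Finset.sum_le_sum fun j hj => hgeo j (Finset.mem_range.mp hj)
      _ = θ' * ∑ j ∈ Finset.range k, ρ ^ (4 * (k₀ - j)) := by rw [Finset.mul_sum]
      _ ≤ θ' * (ρ ^ 4 / (1 - ρ ^ 4)) := mul_le_mul_of_nonneg_left (geom_sum_top_le hρ0.le hρ1 hk) hθ'
  have hexp : Real.exp (1 / ρ * ∑ j ∈ Finset.range k, κ' j) ≤ Real.exp (θ' * (ρ ^ 3 / (1 - ρ ^ 4))) := by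
    apply Real.exp_le_exp.mpr
    calc 1 / ρ * ∑ j ∈ Finset.range k, κ' j ≤ 1 / ρ * (θ' * (ρ ^ 4 / (1 - ρ ^ 4))) :=
          mul_le_mul_of_nonneg_left hsum (by positivity)
      _ = θ' * (ρ ^ 3 / (1 - ρ ^ 4)) := by field_simp
  have hterm : ∀ j ∈ Finset.range k, ρ ^ (k - 1 - j) * r j ≤ θ₂ * E * m₀ * (ρ ^ (2 * k₀ + 1 - k) * (ρ ^ 2) ^ (k - 1 - j)) := by
    intro j hj
    have hjk := Finset.mem_range.mp hj
    calc ρ ^ (k - 1 - j) * r j ≤ ρ ^ (k - 1 - j) * (θ₂ * ρ ^ (2 * (k₀ - j)) * (E * ρ ^ j * m₀)) :=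
          mul_le_mul_of_nonneg_left (hrgeo j hjk) (pow_nonneg hρ0.le _)
      _ = θ₂ * E * m₀ * (ρ ^ (k - 1 - j) * ρ ^ (2 * (k₀ - j)) * ρ ^ j) := by ring
      _ = θ₂ * E * m₀ * (ρ ^ (2 * k₀ + 1 - k) * (ρ ^ 2) ^ (k - 1 - j)) := by rw [pow_mul_pow_mul_pow_eq_sharp ρ hjk hk]
  have hS : ∑ j ∈ Finset.range k, ρ ^ (k - 1 - j) * r j ≤ θ₂ * E * m₀ * (ρ ^ (2 * k₀ + 1 - k) / (1 - ρ ^ 2)) := by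
    refine (Finset.sum_le_sum hterm).trans ?_
    rw [← Finset.mul_sum, ← Finset.mul_sum, Finset.sum_range_reflect (fun i => (ρ ^ 2) ^ i) k]
    have hgeom : ∑ i ∈ Finset.range k, (ρ ^ 2) ^ i ≤ 1 / (1 - ρ ^ 2) := by
      rw [le_div_iff₀ h12, geom_sum_mul_neg (ρ ^ 2) k]
      have : 0 ≤ (ρ ^ 2) ^ k := pow_nonneg (sq_nonneg ρ) k
      linarith
    have h0 : 0 ≤ θ₂ * E * m₀ * ρ ^ (2 * k₀ + 1 - k) := by positivity
    calc θ₂ * E * m₀ * (ρ ^ (2 * k₀ + 1 - k) * ∑ i ∈ Finset.range k, (ρ ^ 2) ^ i)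
        = (θ₂ * E * m₀ * ρ ^ (2 * k₀ + 1 - k)) * ∑ i ∈ Finset.range k, (ρ ^ 2) ^ i := by ring
      _ ≤ (θ₂ * E * m₀ * ρ ^ (2 * k₀ + 1 - k)) * (1 / (1 - ρ ^ 2)) := mul_le_mul_of_nonneg_left hgeom h0
      _ = _ := by ring
  have hS0 : 0 ≤ ∑ j ∈ Finset.range k, ρ ^ (k - 1 - j) * r j := Finset.sum_nonneg fun j _ => mul_nonneg (pow_nonneg hρ0.le _) (hr j)
  calc n k ≤ Real.exp (1 / ρ * ∑ j ∈ Finset.range k, κ' j) * ∑ j ∈ Finset.range k, ρ ^ (k - 1 - j) * r j := h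
    _ ≤ Real.exp (θ' * (ρ ^ 3 / (1 - ρ ^ 4))) * (θ₂ * E * m₀ * (ρ ^ (2 * k₀ + 1 - k) / (1 - ρ ^ 2))) :=
        mul_le_mul hexp hS hS0 (Real.exp_pos _).le

end Summit.QuantumFields.YangMills.Theorems.Prop7CornerCombLevelInduction

end
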